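import Summits.BirchSwinnertonDyer.BirchSwinnertonDyer.Theses.CongruentShaFreeCut
import Literature.NumberTheory.EllipticCurves.Castella2018.AnticyclotomicSelmerDual
import Literature.NumberTheory.EllipticCurves.IwasawaEulerCharRankZeroProofs
import Literature.NumberTheory.EllipticCurves.BSDSelmerCMPConverseHeegnerDescentProofs
import Literature.NumberTheory.EllipticCurves.IwasawaAlgebra
import Summits.BirchSwinnertonDyer.BirchSwinnertonDyer.Theorems.CongruentShaFreeCutTwoAdicLinks

/-! # Route `CongruentShaFreeCut` (rung S2) — crux `AnalyticRankOneOfRankOneFiniteShaTwo`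
(stmt-BirchSwinnertonDyer-19080): the `Λ`-module step of Link A (`TwoAdicControlOfRankOne`) is a
theorem — «`𝔛` finitely generated with finite `Γ`-coinvariants ⟹ `𝔛` is `Λ`-torsion and `f(0) ≠ 0`»

Link A of the typed split of crux B (`Summit.….Theorems.CongruentShaFreeCutTwoAdicLinks.
TwoAdicControlOfRankOne`, ty g2, filed p424074): for the Pontryagin dual
`𝔛 = AcSelmer.XAc ((E_n)_K) 2 κ v̄ ∅ γ` of the anticyclotomic Selmer group of `E_n` over `K_∞/K`
(strict at `v̄`, relaxed at `v`, trivial off `2`; Castella 2018 Def. 2.2), «`rank E_n(K) = 1 ∧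
#Ш(E_n/K)[2^∞] < ∞ ⟹ ∃ m, AcSelmer.XAc.HasCharValuationAt … m`», i.e. `𝔛` is `Λ`-torsion and a
generator `f` of `char_Λ 𝔛` has `f(0) ≠ 0`. The seat's written proof (HOME/bsd-cn100-s2-c3/
MEMO-LinkA-TwoAdicControlOfRankOne.md, for the referee) has seven steps; Steps 1–6 are Galois
cohomology (Poitou–Tate twice, finiteness of `E_n[2^∞]` over abelian extensions of `ℚ₂`, control
for relaxed/strict conditions) and end in: **`𝔛` is finitely generated over `Λ = ℤ₂⟦T⟧` and
`𝔛/T𝔛 = (Sel_∞^Γ)^∨` is finite**. Step 7 — from there to the typed conclusion — is pure `Λ`-module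
theory, and THIS FILE PROVES IT, for Castella's real module at ANY curve, prime, `ℤ_p`-extension and
imprimitivity set:

* `isTorsion_of_finite_coinvariants` (folklore; Greenberg LNM 1716 §1 / Washington §13.2): a finitely
  generated `Λ`-module `X` with `X/TX` finite is `Λ`-torsion. Proof through local lengths at
  `𝔭 = (T)`: `rank_Λ X = ℓ_𝔭((X/X_tor)_Γ)` (tree `lengthAt_coinvariants_eq_finrank_of_isTorsionFree`)
  `≤ ℓ_𝔭(X_Γ)` (right exactness of `Γ`-coinvariants) `= rank_{ℤ_p} X/TX = 0`.
* `AcSelmer.XAc.hasCharValuationAt_of_finite_coinvariants`: for `𝔛 = XAc W p κ 𝔭 S γ` finitely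
  generated with finite coinvariants, `∃ n, HasCharValuationAt W p κ 𝔭 S γ n` — torsion by the
  above, principal characteristic ideal (`charIdeal_isPrincipal_holds`), `f(0) ≠ 0` by Greenberg's
  Lemma 4.2 (tree `constantCoeff_charGenerator_ne_zero_of_finite_coinvariants`).

So, kernel-checked, Link A at `(E_n, 2)` — and its S2b twin `ThreeAdicControlOfRankOne` at
`(y² = x³ + D, 3)`, and the analogous links of any additive-prime rung — REDUCES to the control
statement «`𝔛` finitely generated and `Sel_{v̄}^{∅}(K_∞, E[p^∞])^Γ` finite under rank 1 ∧ Ш[p^∞]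
finite», which is what the memo proves on paper (not in print at an additive prime; no Poitou–Tate
for Selmer structures in the tree yet, hence not formalised here). Supports, does not close,
stmt-BirchSwinnertonDyer-19080; no new definition, no named fact, nothing asserted about `E_n`. -/

noncomputable section

universe u v

namespace Summit.BirchSwinnertonDyer.BirchSwinnertonDyer.Theorems.CongruentShaFreeCutTwoAdicControlReduction

open Literature.NumberTheory.EllipticCurves
open Literature.NumberTheory.EllipticCurves.IwasawaAlgebra
open NumberField IsDedekindDomain Field

/-! ### Step 7a: finite `Γ`-coinvariants force `Λ`-torsion -/

/-- **A finitely generated `Λ = ℤ_p⟦T⟧`-module `X` with finite `Γ`-coinvariants `X/TX` is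
`Λ`-torsion** (folklore; Greenberg, LNM 1716, §1; Washington §13.2: in structure-theorem terms
`rank_{ℤ_p} X/TX ≥ rank_Λ X`). Proof: with `Q = X/X_tor` (torsion-free, same `Λ`-rank),
`rank_Λ X = rank_Λ Q = ℓ_{(T)}(Q_Γ) ≤ ℓ_{(T)}(X_Γ) = rank_{ℤ_p} X/TX = 0`, using the tree's
`lengthAt_coinvariants_eq_finrank_of_isTorsionFree`, the surjection `X_Γ ↠ Q_Γ` and
`coinvariantsRank_eq_zero_of_finite`. [cite: GreenbergLNM1716, §1 p. 57 and p. 65] -/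
theorem isTorsion_of_finite_coinvariants (p : ℕ) [Fact p.Prime] (X : Type u) [AddCommGroup X]
    [Module (IwasawaAlgebra p) X] [Module.Finite (IwasawaAlgebra p) X]
    (hfin : Finite (coinvariants p X)) : Module.IsTorsion (IwasawaAlgebra p) X := by
  set Xt := Submodule.torsion (IwasawaAlgebra p) X with hXt
  -- `rank_Λ (X/X_tor) = rank_Λ X`
  have hQ : Module.finrank (IwasawaAlgebra p) (X ⧸ Xt) = Module.finrank (IwasawaAlgebra p) X := by
    have h := Submodule.finrank_quotient_add_finrank Xt
    rw [Module.finrank_eq_zero_iff_isTorsion.mpr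
      (Submodule.torsion_isTorsion (R := IwasawaAlgebra p) (M := X)), add_zero] at h
    exact h
  -- `ℓ(Q_Γ) ≤ ℓ(X_Γ) = rank_{ℤ_p} X/TX = 0`
  have hle : Module.lengthAt (IwasawaAlgebra p) (coinvariants p (X ⧸ Xt)) (primeT p) ≤
      Module.lengthAt (IwasawaAlgebra p) (coinvariants p X) (primeT p) :=
    length_localizedModule_primeT_le_of_surjective p _
      (coinvariantsMap_surjective Xt.mkQ (Submodule.mkQ_surjective _))
  rw [lengthAt_coinvariants_eq_finrank_of_isTorsionFree p (Q := X ⧸ Xt), hQ,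
    lengthAt_coinvariants_eq_coinvariantsRank p X, coinvariantsRank_eq_zero_of_finite p X hfin,
    Nat.cast_zero, nonpos_iff_eq_zero, Nat.cast_eq_zero] at hle
  exact Module.finrank_eq_zero_iff_isTorsion.mp hle

/-- The same with the conclusion packaged as Greenberg's Lemma 4.2: **finitely generated with finite
`Γ`-coinvariants ⟹ `Λ`-torsion with a characteristic generator `f`, `f(0) ≠ 0`**
(`charIdeal_isPrincipal_holds`, `constantCoeff_charGenerator_ne_zero_of_finite_coinvariants`).
[cite: GreenbergLNM1716, §4 Lemma 4.2] -/
theorem isTorsion_and_exists_charGenerator_constantCoeff_ne_zero (p : ℕ) [Fact p.Prime]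
    (X : Type u) [AddCommGroup X] [Module (IwasawaAlgebra p) X] [Module.Finite (IwasawaAlgebra p) X]
    (hfin : Finite (coinvariants p X)) :
    Module.IsTorsion (IwasawaAlgebra p) X ∧
      ∃ f : IwasawaAlgebra p, Module.charIdeal (IwasawaAlgebra p) X = Ideal.span {f} ∧
        PowerSeries.constantCoeff f ≠ 0 := by
  have htors := isTorsion_of_finite_coinvariants p X hfin
  obtain ⟨f, hf⟩ := (charIdeal_isPrincipal_holds p X).principal
  have hf' : Module.charIdeal (IwasawaAlgebra p) X = Ideal.span {f} := hf
  exact ⟨htors, f, hf', constantCoeff_charGenerator_ne_zero_of_finite_coinvariants p X htors f hf' hfin⟩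

/-! ### Step 7b: the typed conclusion of Link A on Castella's real module -/

/-- **Link A's `Λ`-module step, on the real module.** For Castella's dual anticyclotomic Selmer module
`𝔛 = X_ac^Σ(E[p^∞]) = AcSelmer.XAc W p κ 𝔭 S γ` (ANY curve `W/K`, prime `p`, `ℤ_p`-extension `κ`
with topological generator `γ`, distinguished prime `𝔭`, set `Σ = S`): if `𝔛` is finitely generated
over `Λ` and its `Γ`-coinvariants `𝔛/T𝔛 = (Sel^Γ)^∨` are finite, then `𝔛` is `Λ`-torsion and a
generator `f` of `Ch_Λ(𝔛)` has `f(0) ≠ 0`, i.e. `HasCharValuationAt W p κ 𝔭 S γ (ord_p f(0))`.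
This is the last step of every anticyclotomic control theorem (Greenberg LNM 1716 Lemma 4.2; CGLS
2022 Thm. 5.1.1; Castella 2018 Thm. 2.3), valid irrespective of the reduction type; the remaining
content of Link A `…CongruentShaFreeCutTwoAdicLinks.TwoAdicControlOfRankOne` at the additive prime
`2` is exactly the two hypotheses here (finite generation and finiteness of `Sel_∞^Γ`).
[cite: GreenbergLNM1716, §4 Lemma 4.2] [cite: Castella2018, Thm. 2.3 (arXiv:1704.06608 p. 5) (shape)] -/
theorem hasCharValuationAt_of_finite_coinvariants {K : Type u} [Field K] [NumberField K]
    (W : WeierstrassCurve K) (p : ℕ) [Fact p.Prime] (κ : ZpExtension K p)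
    (𝔭 : HeightOneSpectrum (𝓞 K)) (S : Set (HeightOneSpectrum (𝓞 K)))
    (γ : absoluteGaloisGroup K) [Fact (κ.IsTopGenerator γ)]
    [Module.Finite (IwasawaAlgebra p) (Castella2018.AcSelmer.XAc W p κ 𝔭 S γ)]
    (hfin : Finite (coinvariants p (Castella2018.AcSelmer.XAc W p κ 𝔭 S γ))) :
    ∃ n : ℕ, Castella2018.AcSelmer.XAc.HasCharValuationAt W p κ 𝔭 S γ n := by
  obtain ⟨htors, f, hf, hf0⟩ := isTorsion_and_exists_charGenerator_constantCoeff_ne_zero p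
    (Castella2018.AcSelmer.XAc W p κ 𝔭 S γ) hfin
  exact ⟨_, Castella2018.AcSelmer.XAc.hasCharValuationAt_of_eq htors hf hf0 rfl⟩


/-! ### Step 7c: Link A for `E_n` at `p = 2` from the control statement (appended once the links
file `CongruentShaFreeCutTwoAdicLinks` landed, p424074) -/

/-- **Link A `TwoAdicControlOfRankOne` REDUCES to the control/finiteness statement of the written
proof** (MEMO-LinkA Steps 1–6): if, at every datum of Link A — square-free `n`, `K` imaginary
quadratic with the Heegner hypothesis for `N = N(E_n)` and for `2`, `ι : K ↪ ℚ₂` inducing `v`,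
`v̄ ∋ 2`, `v̄ ≠ v`, `κ` anticyclotomic with topological generator `γ`, `rank E_n(K) = 1`,
`#Ш(E_n/K)[2^∞] < ∞` — the dual Selmer module `𝔛 = AcSelmer.XAc ((E_n)_K) 2 κ v̄ ∅ γ` is finitely
generated over `Λ = ℤ₂⟦T⟧` with finite `Γ`-coinvariants `𝔛/T𝔛` (⟸ `Sel_{v̄}^{∅}(K_∞, E_n[2^∞])^Γ`
finite: Poitou–Tate twice + control for relaxed/strict conditions + finiteness of `E_n[2^∞]` over
abelian extensions of `ℚ₂`, none of it in print at an additive prime), then Link A holds, by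
`hasCharValuationAt_of_finite_coinvariants`. The hypothesis is stated inline (no new definition); it
is the honest residue of Link A in tree currency. [cite: GreenbergLNM1716, §4 Lemma 4.2]
[cite: Castella2018, Thm. 2.3 (arXiv:1704.06608 p. 5) (shape)] -/
theorem twoAdicControlOfRankOne_of_finite_coinvariants
    (hctl : ∀ ⦃n : ℕ⦄, Squarefree n → ∀ (K : Type) [Field K] [NumberField K] (N : ℕ) [NeZero N],
      (congruentNumberCurve n).conductorNorm ℤ = N → IsImaginaryQuadratic K →
        SatisfiesHeegnerHypothesis N K → SatisfiesHeegnerHypothesis 2 K →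
      ∀ (ι : K →+* ℚ_[2]) (v vbar : HeightOneSpectrum (𝓞 K)),
        (∀ x : 𝓞 K, x ∈ v.asIdeal ↔ ‖ι (x : K)‖ < 1) →
        ((2 : ℕ) : 𝓞 K) ∈ vbar.asIdeal → vbar ≠ v →
      ∀ (κ : ZpExtension K 2), κ.IsAnticyclotomic →
      ∀ (γ : absoluteGaloisGroup K) [Fact (κ.IsTopGenerator γ)],
        ((congruentNumberCurve n).baseChange K).mordellWeilRank = 1 →
        Finite (AddCommGroup.primaryComponent ((congruentNumberCurve n).baseChange K).sha 2) →
        Module.Finite (IwasawaAlgebra 2)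
            (Castella2018.AcSelmer.XAc ((congruentNumberCurve n).baseChange K) 2 κ vbar ∅ γ) ∧
          Finite (coinvariants 2
            (Castella2018.AcSelmer.XAc ((congruentNumberCurve n).baseChange K) 2 κ vbar ∅ γ))) :
    CongruentShaFreeCutTwoAdicLinks.TwoAdicControlOfRankOne := by
  intro n hn K _ _ N _ hN hK hHN hH2 ι v vbar hv hvbar hne κ hκ γ _ hrank hsha
  obtain ⟨hfg, hfin⟩ := hctl hn K N hN hK hHN hH2 ι v vbar hv hvbar hne κ hκ γ hrank hsha
  haveI := hfg
  exact hasCharValuationAt_of_finite_coinvariants _ 2 κ vbar ∅ γ hfin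

end Summit.BirchSwinnertonDyer.BirchSwinnertonDyer.Theorems.CongruentShaFreeCutTwoAdicControlReduction

end
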